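import Summits.ResolutionOfSingularities.ResolutionOfSingularities.Theorems.FRationalModification.Negative.LoadBearing
import Summits.ResolutionOfSingularities.ResolutionOfSingularities.Theorems.FrobeniusLadderFRationalModificationMaxMultiplicityCertificate
import Summits.ResolutionOfSingularities.ResolutionOfSingularities.Theorems.FrobeniusLadderFRationalResolutionStubClauseOfRingEquiv
import Literature.AlgebraicGeometry.Resolution.AffineBlowupUniversal
import Literature.AlgebraicGeometry.Resolution.Blowups
import Mathlib.RingTheory.RegularLocalRing.Defs
import HarnessLib

/-!
# Pointwise rung-3-or-certified transfers from any blowing up to the constructed one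
# (crux `FrobeniusLadder.FRationalModification`, line `socle-discrepancy-certificate`)

Support file for crux stmt-ResolutionOfSingularities-15316
(`Summit.ResolutionOfSingularities.ResolutionOfSingularities.Theses.FrobeniusLadder.FRationalModification`, route
FrobeniusLadder), line `socle-discrepancy-certificate` (skeleton v4), registered sub-goal
`blowupCertificate_of_isBlowup`.

The line's local producer (S2') and the landed finite-defect globaliser
(`FiniteDefectGlobal.rungThreeModel_of_finiteDefect`) speak about the CONSTRUCTED blowing up
`affineBlowup I = Proj R[It]` of `Spec R` along an ideal `I` (`AffineBlowup.lean`), in the form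
"every local ring of `affineBlowup I` satisfies the rung-3 clause (domain, every ideal generated by a system of
parameters tightly closed) OR carries a certificate (domain with `t ∈ 𝔪 ∖ 0`, `𝒪[1/t]` regular, `𝒪/(t)`
Cohen–Macaulay with Frobenius-closed parameter ideals)". Producers are naturally stated for SOME blowing up
`π : X' → Spec R` of `Spec R` along `Ĩ`, i.e. a morphism with the universal property
`IsBlowup π (affineBlowup.idealSheaf I)` (Görtz–Wedhorn I, Def. 13.90). This file is the bridge:

* `blowupCertificate_of_isBlowup` — if every local ring of such an `X'` is rung-3 or certified, so is every
  local ring of `affineBlowup I`. Proof: the constructed blowing up has the universal property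
  (`affineBlowup.isBlowup`, GW Prop. 13.92), two blowing ups along the same centre are isomorphic over the base
  (`IsBlowup.unique`), an isomorphism of schemes induces isomorphisms of stalks, and both the rung-3 clause
  (`FRationalResolution.ClauseInvariance.stub_clause_of_ringEquiv`) and the certificate
  (`MaxMultiplicityCertificate.good_of_ringEquiv`) transport along ring isomorphisms; a regular local ring of
  characteristic `p` is rung-3 (`Negative.rungThree_of_isRegularLocalRing`), the stalks of `affineBlowup I`
  having characteristic `p` through `Bl_I(Spec R) → Spec R → Spec 𝔽_p` (`Negative.charP_stalk`).

No definition is declared; the statement is written inline in the route file's vocabulary.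

## Sources
* U. Görtz, T. Wedhorn, *Algebraic Geometry I* (2nd ed. 2020), Def. 13.90, (13.19), Prop. 13.92 (blowing up:
  universal property, uniqueness, the affine construction; in tree `IsBlowup.unique`, `affineBlowup.isBlowup`).
* The Stacks Project, Tag 0804 (blowing up an affine scheme; in tree `affineBlowup`).
* C. Huneke, I. Swanson, *Integral closure of ideals, rings, and modules*, Thm. 13.1.2 (6) (ideals of a regular
  ring are tightly closed; in tree through `Negative.rungThree_of_isRegularLocalRing`). [folklore]
-/

-- single-problem summit: the doubled namespace component `ResolutionOfSingularities` is forced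
set_option linter.dupNamespace false

noncomputable section

open CategoryTheory AlgebraicGeometry IsLocalRing
open Literature.AlgebraicGeometry.Resolution
open Summit.ResolutionOfSingularities.ResolutionOfSingularities.Theorems
open Summit.ResolutionOfSingularities.ResolutionOfSingularities.Theorems.FRationalModification

namespace Summit.ResolutionOfSingularities.ResolutionOfSingularities.Theorems.FRationalModification.BlowupCertificateOfIsBlowup

/-- **Pointwise "rung-3 or certified" transfers from any blowing up of `Spec R` along `Ĩ` to the constructed
blowing up `affineBlowup I`** (registered sub-goal `blowupCertificate_of_isBlowup` of crux
stmt-ResolutionOfSingularities-15316, line `socle-discrepancy-certificate`). If `π : X' → Spec R` is a blowing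
up along the ideal sheaf of `I` (universal property `IsBlowup`) and every local ring of `X'` satisfies the
rung-3 clause or carries a certificate, then so does every local ring of `affineBlowup I`: by uniqueness of
blowing ups (`IsBlowup.unique` with `affineBlowup.isBlowup`) there is an isomorphism `affineBlowup I ≅ X'` over
`Spec R`, whose stalk maps are ring isomorphisms, and both clauses are invariant under ring isomorphisms
(`stub_clause_of_ringEquiv`, `good_of_ringEquiv`; a regular stalk is rung-3 by
`Negative.rungThree_of_isRegularLocalRing`, its characteristic being `p` via `Spec R → Spec 𝔽_p`).
[cite: GortzWedhorn2020, (13.19), Prop. 13.92] -/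
theorem blowupCertificate_of_isBlowup (p : ℕ) [Fact p.Prime] (R : Type) [CommRing R] [CharP R p] (I : Ideal
    R) (X' : Scheme.{0}) (π : X' ⟶ Spec (.of R)) (hπ : IsBlowup π (affineBlowup.idealSheaf I)) (hgood : ∀ x
    : X', (IsDomain (X'.presheaf.stalk x) ∧ ∀ d : ℕ, ringKrullDim (X'.presheaf.stalk x) = d → ∀ s : Fin d →
    (X'.presheaf.stalk x), (Ideal.span (Set.range s)).radical.IsMaximal → ∀ u c : (X'.presheaf.stalk x), c ≠
    0 → (∀ e : ℕ, c * u ^ p ^ e ∈ Ideal.span ((fun z : (X'.presheaf.stalk x) => z ^ p ^ e) '' (Ideal.span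
    (Set.range s) : Set (X'.presheaf.stalk x)))) → u ∈ Ideal.span (Set.range s)) ∨ (IsDomain
    ((X'.presheaf.stalk x)) ∧ ∃ t : (X'.presheaf.stalk x), t ∈ IsLocalRing.maximalIdeal ((X'.presheaf.stalk
    x)) ∧ t ≠ 0 ∧ IsRegularRing (Localization.Away t) ∧ (∀ d : ℕ, ringKrullDim ((X'.presheaf.stalk x) ⧸
    Ideal.span {t}) = d → ∀ s : Fin d → (X'.presheaf.stalk x) ⧸ Ideal.span {t}, (Ideal.span (Set.range
    s)).radical.IsMaximal → RingTheory.Sequence.IsWeaklyRegular ((X'.presheaf.stalk x) ⧸ Ideal.span {t})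
    (List.ofFn s) ∧ ∀ u : (X'.presheaf.stalk x) ⧸ Ideal.span {t}, (∃ e : ℕ, u ^ p ^ e ∈ Ideal.span ((fun z :
    (X'.presheaf.stalk x) ⧸ Ideal.span {t} => z ^ p ^ e) '' (Ideal.span (Set.range s) : Set
    ((X'.presheaf.stalk x) ⧸ Ideal.span {t})))) → u ∈ Ideal.span (Set.range s)))) : ∀ w : affineBlowup I,
    (IsDomain ((affineBlowup I).presheaf.stalk w) ∧ ∀ d : ℕ, ringKrullDim ((affineBlowup I).presheaf.stalk
    w) = d → ∀ s : Fin d → ((affineBlowup I).presheaf.stalk w), (Ideal.span (Set.range s)).radical.IsMaximal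
    → ∀ u c : ((affineBlowup I).presheaf.stalk w), c ≠ 0 → (∀ e : ℕ, c * u ^ p ^ e ∈ Ideal.span ((fun z :
    ((affineBlowup I).presheaf.stalk w) => z ^ p ^ e) '' (Ideal.span (Set.range s) : Set ((affineBlowup
    I).presheaf.stalk w)))) → u ∈ Ideal.span (Set.range s)) ∨ (IsDomain (((affineBlowup I).presheaf.stalk
    w)) ∧ ∃ t : ((affineBlowup I).presheaf.stalk w), t ∈ IsLocalRing.maximalIdeal (((affineBlowup
    I).presheaf.stalk w)) ∧ t ≠ 0 ∧ IsRegularRing (Localization.Away t) ∧ (∀ d : ℕ, ringKrullDim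
    (((affineBlowup I).presheaf.stalk w) ⧸ Ideal.span {t}) = d → ∀ s : Fin d → ((affineBlowup
    I).presheaf.stalk w) ⧸ Ideal.span {t}, (Ideal.span (Set.range s)).radical.IsMaximal →
    RingTheory.Sequence.IsWeaklyRegular (((affineBlowup I).presheaf.stalk w) ⧸ Ideal.span {t}) (List.ofFn s)
    ∧ ∀ u : ((affineBlowup I).presheaf.stalk w) ⧸ Ideal.span {t}, (∃ e : ℕ, u ^ p ^ e ∈ Ideal.span ((fun z :
    ((affineBlowup I).presheaf.stalk w) ⧸ Ideal.span {t} => z ^ p ^ e) '' (Ideal.span (Set.range s) : Set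
    (((affineBlowup I).presheaf.stalk w) ⧸ Ideal.span {t})))) → u ∈ Ideal.span (Set.range s))) := by
  have hp : p.Prime := Fact.out
  -- the constructed blowing up is a blowing up; two blowing ups along the same centre are isomorphic
  obtain ⟨e, -, -⟩ := (affineBlowup.isBlowup I).unique hπ
  intro w
  -- stalks of `affineBlowup I` have characteristic `p` (structure map to `Spec 𝔽_p`)
  haveI : CharP ((affineBlowup I).presheaf.stalk w) p :=
    Negative.charP_stalk (affineBlowup.π I ≫ Spec.map (CommRingCat.ofHom (ZMod.castHom (dvd_refl p) R))) w
  -- the stalk isomorphism `𝒪_{X', e w} ≃+* 𝒪_{Bl_I, w}`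
  let E : X'.presheaf.stalk (e.hom.base w) ≃+* (affineBlowup I).presheaf.stalk w :=
    (asIso (e.hom.stalkMap w)).commRingCatIsoToRingEquiv
  rcases hgood (e.hom.base w) with h3 | hc
  · -- the rung-3 clause transports along the stalk isomorphism
    exact Or.inl (FRationalResolution.ClauseInvariance.stub_clause_of_ringEquiv p E h3)
  · -- the certificate transports along the stalk isomorphism; a regular stalk is rung-3
    rcases MaxMultiplicityCertificate.good_of_ringEquiv p E (Or.inr hc) with hreg | hc'
    · exact Or.inl (Negative.rungThree_of_isRegularLocalRing hp _ hreg)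
    · exact Or.inr hc'

end Summit.ResolutionOfSingularities.ResolutionOfSingularities.Theorems.FRationalModification.BlowupCertificateOfIsBlowup

end
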